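import Summits.Parity.GeneralizedHardyLittlewood.Theorems.FordMaynardSieveConst01651SieveConst01651SliceKernel
import HarnessLib

/-!
# Route `FordMaynardSieveConst01651`, target `SieveConst01651` (stmt-Parity-19185), line `sieve_decomposition`,
# stub `stub_coneCertClosed`: the subvector sum `(𝟙⋆g)(x)/∏ xᵢ` under a box slice integral, term by term

Helper file (def-free), continuation of `…SieveConst01651SliceKernel` (K. Ford, J. Maynard, *On the theory of prime
producing sieves*, arXiv:2407.14368, Theorem 7.3 (a)).  The certificate value `sieveBoundG1 ν g` integrates
`(𝟙⋆g)(x)/(x₁⋯x_k) = ∑_{A ⊆ [k]} g_{|A|}(x_A)/∏ xᵢ` over slices; here: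

* `measurable_boxIntegrand`, `abs_boxIntegrand_le` — the box integrand `𝟙[xᵢ > ν ∀ i]·G(x)/∏ xᵢ` is measurable and
  bounded by `sup|G|/ν^d`;
* `sliceIntegral_box_finset_sum` — **linearity**: the box slice integral of a finite sum `∑_{a ∈ T} G_a` is the sum of
  the box slice integrals (bounded measurable summands);
* `exists_perm_castAdd_eq_orderEmb` — for `A ⊆ Fin((a+1)+(b+1))` with `|A| = a+1`, a permutation carrying the first
  block onto `A` in increasing order;
* `sliceIntegral_subvector_term` — **every `|A| = a+1` term is the first-block term**: for bounded measurable `γ` on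
  `ℝ^{a+1}`, `∫_{|x| = w} 𝟙[xᵢ > ν] γ(x_A)/∏ xᵢ = ∫_{t ∈ (0,w]} (∫_{|v|=t} 𝟙[vᵢ>ν] γ(v)/∏ vᵢ) · F_{b+1}(w − t) dt`
  (permutation invariance of slice integrals, tree `sliceIntegral_comp_perm`, then `sliceIntegral_box_split`) — so
  the `k`-dimensional integral of `(𝟙⋆g)/∏` is a finite combination of ONE-dimensional integrals of the cone data's
  own slice functions against the universal kernels `F_m`.

References: [FordMaynard2024PrimeSieves] arXiv:2407.14368, Definition 7.1 (`𝟙⋆g`), Theorem 7.3 (a), §4.2.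
-/

noncomputable section

open MeasureTheory Set Finset
open scoped Classical
open Literature.NumberTheory.Sieve Literature.NumberTheory.Sieve.FordMaynard

namespace Summit.Parity.GeneralizedHardyLittlewood.FordMaynardSieveConst01651SieveConst01651

/-! ### The box integrand: measurability and bound -/

/-- The box `{x : xᵢ > ν ∀ i}` is measurable. [folklore] -/
theorem measurableSet_box (d : ℕ) (ν : ℝ) : MeasurableSet {x : Fin d → ℝ | ∀ i, ν < x i} := by
  have : {x : Fin d → ℝ | ∀ i, ν < x i} = ⋂ i, (fun x => x i) ⁻¹' Set.Ioi ν := by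
    ext x; simp
  rw [this]
  exact MeasurableSet.iInter fun i => measurable_pi_apply i measurableSet_Ioi

/-- The box integrand `𝟙[xᵢ > ν ∀ i]·G(x)/∏ xᵢ` of a measurable `G` is measurable. [folklore] -/
theorem measurable_boxIntegrand {d : ℕ} (ν : ℝ) {G : (Fin d → ℝ) → ℝ} (hG : Measurable G) :
    Measurable (fun x : Fin d → ℝ => if ∀ i, ν < x i then G x / ∏ i, x i else 0) :=
  Measurable.ite (measurableSet_box d ν) (hG.div (Finset.measurable_prod _ fun i _ => measurable_pi_apply i))
    measurable_const

/-- The box integrand of a `C`-bounded `G` is bounded by `C/ν^d` (`ν > 0`). [folklore] -/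
theorem abs_boxIntegrand_le {d : ℕ} {ν : ℝ} (hν : 0 < ν) {G : (Fin d → ℝ) → ℝ} {C : ℝ} (hC : 0 ≤ C)
    (hGb : ∀ x, |G x| ≤ C) (x : Fin d → ℝ) :
    |(if ∀ i, ν < x i then G x / ∏ i, x i else 0)| ≤ C / ν ^ d := by
  split_ifs with hx
  · exact (abs_div_prod_le_of_box hν hx _).trans (div_le_div_of_nonneg_right (hGb x) (pow_pos hν _).le)
  · rw [abs_zero]; positivity

/-! ### Linearity over finite sums -/

/-- **Linearity of box slice integrals over finite sums** of bounded measurable summands: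
`∫_{|x|=w} 𝟙[xᵢ>ν] (∑_{a∈T} G_a(x))/∏ xᵢ = ∑_{a∈T} ∫_{|x|=w} 𝟙[xᵢ>ν] G_a(x)/∏ xᵢ` — the step that takes the subvector
sum `(𝟙⋆g)(x) = ∑_A g(x_A)` out of the integral of Theorem 7.3 (a). [cite: FordMaynard2024PrimeSieves, Definition 7.1 and Theorem 7.3 (a)] -/
theorem sliceIntegral_box_finset_sum {d : ℕ} {ν : ℝ} (hν : 0 < ν) (w : ℝ) {ι : Type*} (T : Finset ι)
    (G : ι → (Fin d → ℝ) → ℝ) (hGm : ∀ a ∈ T, Measurable (G a)) {C : ℝ} (hC : 0 ≤ C)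
    (hGb : ∀ a ∈ T, ∀ x, |G a x| ≤ C) :
    sliceIntegral d w (fun x => if ∀ i, ν < x i then (∑ a ∈ T, G a x) / ∏ i, x i else 0) =
      ∑ a ∈ T, sliceIntegral d w (fun x => if ∀ i, ν < x i then G a x / ∏ i, x i else 0) := by
  induction T using Finset.induction_on with
  | empty =>
    simp only [Finset.sum_empty, zero_div, ite_self]
    exact sliceIntegral_zero d w
  | @insert a T haT ih =>
    have hGm' : ∀ a' ∈ T, Measurable (G a') := fun a' ha' => hGm a' (Finset.mem_insert_of_mem ha')
    have hGb' : ∀ a' ∈ T, ∀ x, |G a' x| ≤ C := fun a' ha' => hGb a' (Finset.mem_insert_of_mem ha')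
    rw [Finset.sum_insert haT, ← ih hGm' hGb']
    have hpt : (fun x : Fin d → ℝ => if ∀ i, ν < x i then (∑ a' ∈ insert a T, G a' x) / ∏ i, x i else 0) =
        fun x => (if ∀ i, ν < x i then G a x / ∏ i, x i else 0) +
          (if ∀ i, ν < x i then (∑ a' ∈ T, G a' x) / ∏ i, x i else 0) := by
      funext x
      rw [Finset.sum_insert haT]
      split_ifs with hx
      · rw [add_div]
      · rw [add_zero]
    rw [hpt]
    -- bounds: the new summand by `C/ν^d`, the partial sum by `T.card * C / ν^d`; use their sum as the common bound
    have hSm : Measurable (fun x : Fin d → ℝ => ∑ a' ∈ T, G a' x) :=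
      Finset.measurable_sum T fun a' ha' => hGm' a' ha'
    have hSb : ∀ x, |∑ a' ∈ T, G a' x| ≤ T.card * C := by
      intro x
      refine (Finset.abs_sum_le_sum_abs _ _).trans ?_
      refine (Finset.sum_le_sum fun a' ha' => hGb' a' ha' x).trans ?_
      rw [Finset.sum_const, nsmul_eq_mul]
    have hTC : 0 ≤ (T.card : ℝ) * C := by positivity
    refine sliceIntegral_add' d w (measurable_boxIntegrand ν (hGm a (Finset.mem_insert_self a T)))
      (measurable_boxIntegrand ν hSm) (C := C / ν ^ d + T.card * C / ν ^ d) (fun x => ?_) (fun x => ?_)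
    · refine (abs_boxIntegrand_le hν hC (hGb a (Finset.mem_insert_self a T)) x).trans ?_
      have : 0 ≤ (T.card : ℝ) * C / ν ^ d := by positivity
      linarith
    · refine (abs_boxIntegrand_le hν hTC hSb x).trans ?_
      have : 0 ≤ C / ν ^ d := by positivity
      linarith

/-! ### Every subvector term is a first-block term -/

/-- **Block-selecting permutation.** For `A ⊆ Fin((a+1)+(b+1))` with `|A| = a+1` there is a permutation `σ` with
`σ(castAdd i) = A.orderEmbOfFin i` for all `i < a+1` (first block ↦ `A` increasingly; second block ↦ `Aᶜ`). [folklore] -/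
theorem exists_perm_castAdd_eq_orderEmb (a b : ℕ) (A : Finset (Fin (a + 1 + (b + 1)))) (hA : A.card = a + 1) :
    ∃ σ : Equiv.Perm (Fin (a + 1 + (b + 1))), ∀ i : Fin (a + 1), σ (Fin.castAdd (b + 1) i) = A.orderEmbOfFin hA i := by
  have hAc : Aᶜ.card = b + 1 := by
    rw [Finset.card_compl, hA, Fintype.card_fin]; omega
  let eA : Fin (a + 1) ≃ {x // x ∈ A} := (A.orderIsoOfFin hA).toEquiv
  let eAc : Fin (b + 1) ≃ {x // x ∉ A} :=
    (Aᶜ.orderIsoOfFin hAc).toEquiv.trans (Equiv.subtypeEquivRight (fun x => Finset.mem_compl))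
  let σ : Equiv.Perm (Fin (a + 1 + (b + 1))) :=
    finSumFinEquiv.symm.trans ((Equiv.sumCongr eA eAc).trans (Equiv.sumCompl (fun x => x ∈ A)))
  refine ⟨σ, fun i => ?_⟩
  simp only [σ, eA, Equiv.trans_apply, finSumFinEquiv_symm_apply_castAdd, Equiv.sumCongr_apply, Sum.map_inl,
    Equiv.sumCompl_apply_inl]
  rfl

/-- **Every `|A| = a+1` subvector term is the first-block term, hence a one-dimensional kernel integral.**
For `ν > 0`, a bounded measurable `γ` on `ℝ^{a+1}`, and `A ⊆ Fin((a+1)+(b+1))` with `|A| = a+1` (subvector `x_A`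
listed increasingly, as in `starSum`):
`∫_{|x| = w} 𝟙[xᵢ > ν ∀ i] γ(x_A)/∏ xᵢ dx = ∫_{t ∈ (0,w]} (∫_{|v| = t} 𝟙[vᵢ > ν] γ(v)/∏ vᵢ dv) · F_{b+1}(w − t) dt`,
`F_{b+1}(s) = ∫_{|u| = s} 𝟙[uⱼ > ν]/∏ uⱼ`.  With `sliceIntegral_box_finset_sum` this writes each summand
`∫ (𝟙⋆g)(x)/(x₁⋯x_k)` of Theorem 7.3 (a) (symmetrised) as `∑_A` of one-dimensional integrals of the cone data's slice
functions against the universal kernels. [cite: FordMaynard2024PrimeSieves, Theorem 7.3 (a) with Definition 7.1 and §4.2] -/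
theorem sliceIntegral_subvector_term (a b : ℕ) {ν : ℝ} (hν : 0 < ν) (w : ℝ)
    (γ : (Fin (a + 1) → ℝ) → ℝ) (hγm : Measurable γ) {C : ℝ} (hC : 0 ≤ C) (hγb : ∀ v, |γ v| ≤ C)
    (A : Finset (Fin (a + 1 + (b + 1)))) (hA : A.card = a + 1) :
    sliceIntegral (a + 1 + (b + 1)) w
        (fun x => if ∀ i, ν < x i then γ (fun i => x (A.orderEmbOfFin hA i)) / ∏ i, x i else 0) =
      ∫ t in Set.Ioc 0 w,
        sliceIntegral (a + 1) t (fun v => if ∀ i, ν < v i then γ v / ∏ i, v i else 0) *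
          sliceIntegral (b + 1) (w - t) (fun u => if ∀ i, ν < u i then 1 / ∏ i, u i else 0) := by
  obtain ⟨σ, hσ⟩ := exists_perm_castAdd_eq_orderEmb a b A hA
  rw [← sliceIntegral_box_split a b hν w γ hγm hC hγb,
    ← sliceIntegral_comp_perm w σ
      (fun z : Fin (a + 1 + (b + 1)) → ℝ =>
        if ∀ i, ν < z i then γ (fun i => z (Fin.castAdd (b + 1) i)) / ∏ i, z i else 0)]
  congr 1
  funext x
  have hiff : (∀ i, ν < (x ∘ σ) i) ↔ ∀ i, ν < x i :=
    ⟨fun h i => by simpa using h (σ.symm i), fun h i => h _⟩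
  have hprod : ∏ i, (x ∘ σ) i = ∏ i, x i := Equiv.prod_comp σ x
  have hsub : (fun i => (x ∘ σ) (Fin.castAdd (b + 1) i)) = fun i => x (A.orderEmbOfFin hA i) := by
    funext i; simp only [Function.comp_apply, hσ]
  simp only [hiff, hprod, hsub]

/-- **Subvector terms in a fixed ambient dimension `k`** (the form met inside `sieveBoundG1`): for `1 ≤ r ≤ k − 1`,
`A ⊆ Fin k` with `|A| = r`, and a bounded measurable `γ` on `ℝ^r`,
`∫_{|x| = w} 𝟙[xᵢ > ν] γ(x_A)/∏ xᵢ = ∫_{t ∈ (0,w]} (∫_{|v|=t} 𝟙[vᵢ>ν] γ(v)/∏ vᵢ) · F_{k−r}(w − t) dt`.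
(Take `r := A.card`, `hA := rfl` to match the summands `g_{|A|}(x_A)` of `starSum` literally.)
[cite: FordMaynard2024PrimeSieves, Theorem 7.3 (a) with Definition 7.1 and §4.2] -/
theorem sliceIntegral_subvector_term' {k r : ℕ} (hr : 1 ≤ r) (hrk : r + 1 ≤ k) {ν : ℝ} (hν : 0 < ν) (w : ℝ)
    (γ : (Fin r → ℝ) → ℝ) (hγm : Measurable γ) {C : ℝ} (hC : 0 ≤ C) (hγb : ∀ v, |γ v| ≤ C)
    (A : Finset (Fin k)) (hA : A.card = r) :
    sliceIntegral k w
        (fun x => if ∀ i, ν < x i then γ (fun i => x (A.orderEmbOfFin hA i)) / ∏ i, x i else 0) =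
      ∫ t in Set.Ioc 0 w,
        sliceIntegral r t (fun v => if ∀ i, ν < v i then γ v / ∏ i, v i else 0) *
          sliceIntegral (k - r) (w - t) (fun u => if ∀ i, ν < u i then 1 / ∏ i, u i else 0) := by
  obtain ⟨a, rfl⟩ : ∃ a, r = a + 1 := ⟨r - 1, by omega⟩
  obtain ⟨b, rfl⟩ : ∃ b, k = a + 1 + (b + 1) := ⟨k - (a + 1) - 1, by omega⟩
  rw [show a + 1 + (b + 1) - (a + 1) = b + 1 by omega]
  exact sliceIntegral_subvector_term a b hν w γ hγm hC hγb A hA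

/-- **The subvector sum under a box slice integral, term by term**: for a vector function `g` with every
`g_r` measurable and `C`-bounded,
`∫_{|x|=w} 𝟙[xᵢ>ν] (𝟙⋆g)(x)/∏ xᵢ = ∑_{A ⊆ [k]} ∫_{|x|=w} 𝟙[xᵢ>ν] g_{|A|}(x_A)/∏ xᵢ`; each summand with
`1 ≤ |A| ≤ k−1` is then a one-dimensional kernel integral by `sliceIntegral_subvector_term'`, the `A = ∅` summand is
`g(∅)·F_k(w)` (`sliceIntegral_const_mul`), and `A = [k]` carries `g_k(x)` itself (zero on `|x| = 1` under the
support clause `|x| ≤ 1/2` of `𝒢₁`). [cite: FordMaynard2024PrimeSieves, Definition 7.1 and Theorem 7.3 (a)] -/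
theorem sliceIntegral_box_starSum (k : ℕ) {ν : ℝ} (hν : 0 < ν) (w : ℝ) (g : VecFn)
    (hgm : ∀ r, Measurable (g r)) {C : ℝ} (hC : 0 ≤ C) (hgb : ∀ r x, |g r x| ≤ C) :
    sliceIntegral k w (fun x => if ∀ i, ν < x i then starSum g k x / ∏ i, x i else 0) =
      ∑ A : Finset (Fin k), sliceIntegral k w
        (fun x => if ∀ i, ν < x i then g A.card (fun i => x (A.orderEmbOfFin rfl i)) / ∏ i, x i else 0) := by
  unfold starSum
  refine sliceIntegral_box_finset_sum hν w (Finset.univ : Finset (Finset (Fin k)))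
    (fun A x => g A.card (fun i => x (A.orderEmbOfFin rfl i))) (fun A _ => ?_) hC (fun A _ x => hgb _ _)
  exact (hgm A.card).comp (measurable_pi_lambda _ fun i => measurable_pi_apply _)

/-- **The empty-subvector term is `g(∅)·F_k(w)`.** [cite: FordMaynard2024PrimeSieves, Definition 7.1 (the term y = ∅)] -/
theorem sliceIntegral_empty_term (k : ℕ) (ν w : ℝ) (g : VecFn) :
    sliceIntegral k w (fun x => if ∀ i, ν < x i then
        g (∅ : Finset (Fin k)).card (fun i => x ((∅ : Finset (Fin k)).orderEmbOfFin rfl i)) / ∏ i, x i else 0) =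
      g 0 Fin.elim0 * sliceIntegral k w (fun u => if ∀ i, ν < u i then 1 / ∏ i, u i else 0) := by
  rw [← sliceIntegral_const_mul]
  congr 1
  funext x
  have key : ∀ (n : ℕ) (f : Fin n → ℝ), n = 0 → g n f = g 0 Fin.elim0 := by
    intro n f hn
    subst hn
    congr 1
    funext i
    exact Fin.elim0 i
  have h0 : g (∅ : Finset (Fin k)).card (fun i => x ((∅ : Finset (Fin k)).orderEmbOfFin rfl i)) = g 0 Fin.elim0 :=
    key _ _ Finset.card_empty
  split_ifs with hx
  · rw [h0, mul_one_div]
  · rw [mul_zero]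

end Summit.Parity.GeneralizedHardyLittlewood.FordMaynardSieveConst01651SieveConst01651

end
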